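import Summits.Ventures.PercRepro.SixFourT4Certificate
import Summits.Ventures.PercRepro.SixFourT4LargeA

/-!
# PercRepro — C-025 at `(6,4)`, §22.5 part 2: the plane-level bridge to the profile certificate, and §22.3 (p3, gen 8)

* The profile of an actual plane trace `ρ = P ∩ G` of rank `3` with `p ≤ 7` points is admissible (`profileOK_of_trace`),
  its entries are bounded as the finite check requires (`inc_bounds_of_trace`), and the plane quantities of §22.1 are
  the profile quantities of `SixFourT4Certificate`: `D3 M G P = D3Prof`, `r34 M G P = r34Prof`
  (`D3_eq_D3Prof`, `r34_eq_r34Prof`), and the lpp credit `Σ_ℓ ε(m_ℓ)·C(p − m_ℓ, 2) = lppProf` (`sum_eps_eq_lppProf`).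
  Hence the certificate `(C_τ)` holds for every such plane (`certQ_of_trace`).
* §22.3, first identity: `Σ_ρ inc(ρ, m)·(p_ρ − m) = (g − m)·b_m` for `m ≥ 2`, `b_m` = the lines meeting `G` in `m`
  points (`sum_inc_mul_eq`: the pairs `(ℓ, x)`, `x ∈ G ∖ ℓ`, are partitioned by the plane `cl(ℓ ∪ x)`); the second,
  `Σ_m C(m,2)·b_m = C(g,2)`, is `sum_choose_two_trace` with `ρ := G`.
-/

namespace PercRepro.SixFour

open Finset ThmH

variable {α : Type*} [DecidableEq α] {M : Matroid α} [M.Finite] {G : Finset α}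

/-! ## The profile of a plane trace is admissible and bounded -/

omit [DecidableEq α] [M.Finite] in
/-- A rank-`3` set has at least `3` points. -/
theorem three_le_card_of_eRk_eq_three {ρ : Finset α} (hr : M.eRk (ρ : Set α) = 3) : 3 ≤ ρ.card := by
  have h := M.eRk_le_encard (ρ : Set α)
  rw [hr, Set.encard_coe_eq_coe_finsetCard] at h
  exact_mod_cast h

/-- The pair identity of a rank-`3` trace with `p ≤ 7` points in profile form:
`inc₂ + 3·inc₃ + 6·inc₄ + 10·inc₅ + 15·inc₆ = C(p, 2)`. -/
theorem pair_identity_of_trace (hs : Simple M) {ρ : Finset α} (hρ : ρ ⊆ gr M) (hr : M.eRk (ρ : Set α) = 3)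
    (h7 : ρ.card ≤ 7) :
    inc M ρ 2 + 3 * inc M ρ 3 + 6 * inc M ρ 4 + 10 * inc M ρ 5 + 15 * inc M ρ 6 = ρ.card.choose 2 := by
  obtain ⟨c12, c22, c32, c42, c52, c62, c72, -, -, -, -, -, -, -⟩ := choose_values
  have hpair := sum_choose_two_trace hs hρ
  have ep := sum_lines_eq_sum_inc (M := M) ρ (fun n => n.choose 2)
  rw [ep, sum_inc_range_eight hr h7] at hpair
  have hi7 : inc M ρ 7 = 0 := inc_eq_zero_of_card_le hr (by omega)
  simp only [Finset.sum_range_succ, Finset.sum_range_zero, Nat.choose_zero_succ, c12, c22, c32, c42, c52, c62, c72,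
    hi7, mul_zero, zero_add, mul_one, zero_mul, add_zero] at hpair
  omega

/-- The profile of a rank-`3` trace with `p ≤ 7` points is admissible. -/
theorem profileOK_of_trace (hs : Simple M) {ρ : Finset α} (hρ : ρ ⊆ gr M) (hr : M.eRk (ρ : Set α) = 3)
    (h7 : ρ.card ≤ 7) :
    ProfileOK ρ.card (inc M ρ 2) (inc M ρ 3) (inc M ρ 4) (inc M ρ 5) (inc M ρ 6) :=
  ⟨pair_identity_of_trace hs hρ hr h7, three_le_card_of_eRk_eq_three hr,
    fun h => inc_eq_zero_of_card_le hr h, fun h => inc_eq_zero_of_card_le hr h,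
    fun h => inc_eq_zero_of_card_le hr h, fun h => inc_eq_zero_of_card_le hr h⟩

/-- The profile entries of a trace with `p ≤ 7` points are bounded as the finite check requires. -/
theorem inc_bounds_of_trace (hs : Simple M) {ρ : Finset α} (hρ : ρ ⊆ gr M) (h7 : ρ.card ≤ 7) :
    inc M ρ 3 < 8 ∧ inc M ρ 4 < 4 ∧ inc M ρ 5 < 3 ∧ inc M ρ 6 < 2 := by
  obtain ⟨-, -, c32, c42, c52, c62, -, -, -, -, -, -, -, -⟩ := choose_values
  have hc2 : ρ.card.choose 2 ≤ 21 := (Nat.choose_le_choose 2 h7).trans (by decide)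
  have hb3 := choose_two_mul_inc_le hs hρ 3
  have hb4 := choose_two_mul_inc_le hs hρ 4
  have hb5 := choose_two_mul_inc_le hs hρ 5
  have hb6 := choose_two_mul_inc_le hs hρ 6
  rw [c32] at hb3
  rw [c42] at hb4
  rw [c52] at hb5
  rw [c62] at hb6
  omega

/-! ## The plane quantities are the profile quantities -/

/-- `D₃(ρ) = δ(p) − Σ_m δ(m)·inc_m` (profile form). -/
theorem D3_eq_D3Prof (hs : Simple M) (hG : G ⊆ gr M) {P : Finset α} (h7 : (P ∩ G).card ≤ 7)
    (hr : M.eRk ((P ∩ G : Finset α) : Set α) = 3) :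
    D3 M G P = D3Prof (P ∩ G).card (inc M (P ∩ G) 4) (inc M (P ∩ G) 5) (inc M (P ∩ G) 6) := by
  set ρ := P ∩ G with hρdef
  have hρ : ρ ⊆ gr M := Finset.inter_subset_right.trans hG
  obtain ⟨d0, d1, d2, d3, d4, d5, d6⟩ := delta_values
  have hD := D3_add_sum_delta hs hρ hr
  have eD := sum_lines_eq_sum_inc (M := M) ρ (fun n => delta n)
  rw [eD, sum_inc_range_eight hr h7] at hD
  have hi7 : inc M ρ 7 = 0 := inc_eq_zero_of_card_le hr (by omega)
  simp only [Finset.sum_range_succ, Finset.sum_range_zero, d0, d1, d2, d3, d4, d5, d6, hi7, mul_zero, zero_add,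
    mul_one, zero_mul, add_zero] at hD
  unfold D3Prof
  rw [d4, d5, d6]
  show (ρ.powerset.filter (fun S : Finset α => 4 ≤ S.card ∧ M.eRk (S : Set α) = 3)).card = _
  omega

/-- `r₃(ρ,4) = C(p,4) − Σ_m C(m,4)·inc_m` (profile form). -/
theorem r34_eq_r34Prof (hs : Simple M) (hG : G ⊆ gr M) {P : Finset α} (h7 : (P ∩ G).card ≤ 7)
    (hr : M.eRk ((P ∩ G : Finset α) : Set α) = 3) :
    r34 M G P = r34Prof (P ∩ G).card (inc M (P ∩ G) 4) (inc M (P ∩ G) 5) (inc M (P ∩ G) 6) := by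
  set ρ := P ∩ G with hρdef
  have hρ : ρ ⊆ gr M := Finset.inter_subset_right.trans hG
  -- the `4`-subsets of `ρ` have rank `3` or `2`
  have hsplit := Finset.card_filter_add_card_filter_not (s := ρ.powersetCard 4)
    (fun Z : Finset α => M.eRk (Z : Set α) = 3)
  have hcongr : (ρ.powersetCard 4).filter (fun Z : Finset α => ¬ M.eRk (Z : Set α) = 3) =
      (ρ.powersetCard 4).filter (fun Z : Finset α => M.eRk (Z : Set α) = 2) := by
    refine Finset.filter_congr (fun Z hZ => ?_)
    obtain ⟨hZρ, hc⟩ := Finset.mem_powersetCard.1 hZ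
    have hle : M.eRk (Z : Set α) ≤ 3 := by rw [← hr]; exact M.eRk_mono (Finset.coe_subset.2 hZρ)
    constructor
    · intro hne
      refine le_antisymm ?_ (two_le_eRk_of_two_le_card hs hρ hZρ (by omega))
      by_contra h
      exact hne (eRk_eq_of_le_of_not_le (n := 2) hle h)
    · intro h2; rw [h2]; decide
  rw [hcongr, card_rank_two_subsets hs hρ (by norm_num : 2 ≤ 4), Finset.card_powersetCard] at hsplit
  have e4 := sum_lines_eq_sum_inc (M := M) ρ (fun n => n.choose 4)
  rw [e4, sum_inc_range_eight hr h7] at hsplit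
  have hi7 : inc M ρ 7 = 0 := inc_eq_zero_of_card_le hr (by omega)
  have hc : Nat.choose 0 4 = 0 ∧ Nat.choose 1 4 = 0 ∧ Nat.choose 2 4 = 0 ∧ Nat.choose 3 4 = 0 ∧ Nat.choose 4 4 = 1 ∧
      Nat.choose 5 4 = 5 ∧ Nat.choose 6 4 = 15 := by decide
  obtain ⟨c0, c1, c2, c3, c4, c5, c6⟩ := hc
  simp only [Finset.sum_range_succ, Finset.sum_range_zero, c0, c1, c2, c3, c4, c5, c6, hi7, mul_zero, zero_add,
    mul_one, zero_mul, add_zero] at hsplit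
  unfold r34Prof
  show (((ρ.powersetCard 4).filter (fun S : Finset α => M.eRk (S : Set α) = 3)).card) = _
  omega

/-- The lpp credit of a trace in profile form: `Σ_ℓ ε(|ℓ ∩ ρ|)·C(p − |ℓ ∩ ρ|, 2) = lppProf`. -/
theorem sum_eps_eq_lppProf {ρ : Finset α} (hr : M.eRk (ρ : Set α) = 3) (h7 : ρ.card ≤ 7) :
    ∑ L ∈ lines M, eps (L ∩ ρ).card * (ρ.card - (L ∩ ρ).card).choose 2 =
      lppProf ρ.card (inc M ρ 3) (inc M ρ 4) (inc M ρ 5) (inc M ρ 6) := by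
  have e := sum_lines_eq_sum_inc (M := M) ρ (fun n => eps n * (ρ.card - n).choose 2)
  rw [e, sum_inc_range_eight hr h7]
  have hi7 : inc M ρ 7 = 0 := inc_eq_zero_of_card_le hr (by omega)
  have he : eps 0 = 0 ∧ eps 1 = 0 ∧ eps 2 = 0 := by decide
  obtain ⟨e0, e1, e2⟩ := he
  simp only [Finset.sum_range_succ, Finset.sum_range_zero, e0, e1, e2, hi7, mul_zero, zero_add, zero_mul, add_zero]
  unfold lppProf
  ring

/-- **The certificate `(C_τ)` holds for every plane trace of rank `3` with `≤ 7` points**, `10 ≤ g ≤ 14`. -/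
theorem certQ_of_trace (hs : Simple M) (hG : G ⊆ gr M) {g : ℕ} (hg : 10 ≤ g) (hg' : g ≤ 14) {P : Finset α}
    (h7 : (P ∩ G).card ≤ 7) (hr : M.eRk ((P ∩ G : Finset α) : Set α) = 3) :
    CertQ g (P ∩ G).card (inc M (P ∩ G) 2) (inc M (P ∩ G) 3) (inc M (P ∩ G) 4) (inc M (P ∩ G) 5)
      (inc M (P ∩ G) 6) := by
  have hρ : P ∩ G ⊆ gr M := Finset.inter_subset_right.trans hG
  obtain ⟨h3, h4, h5, h6⟩ := inc_bounds_of_trace hs hρ h7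
  exact price_certificate hg hg' (by omega) h3 h4 h5 h6 (profileOK_of_trace hs hρ hr h7)

/-! ## §22.3: the planes through an `m`-line partition the points off it -/

/-- `b_m`: the lines meeting `G` in exactly `m` points. -/
noncomputable def bLines (M : Matroid α) [M.Finite] (G : Finset α) (m : ℕ) : ℕ := inc M G m

/-- A line meeting a plane in at least two points lies in the plane. -/
theorem line_subset_plane_of_two_le (hs : Simple M) {L P : Finset α} (hL : L ∈ lines M) (hP : P ∈ planes M)
    (h2 : 2 ≤ (L ∩ P).card) : L ⊆ P := by
  obtain ⟨a, ha, b, hb, hab⟩ := Finset.one_lt_card.1 (by omega : 1 < (L ∩ P).card)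
  have hsub : ({a, b} : Finset α) ⊆ L ∩ P := by
    intro x hx
    simp only [Finset.mem_insert, Finset.mem_singleton] at hx
    rcases hx with rfl | rfl <;> assumption
  have hc : 2 ≤ ({a, b} : Finset α).card := by rw [Finset.card_pair hab]
  have hr := eRk_eq_two_of_subset_line hs hL (hsub.trans Finset.inter_subset_left) hc
  have hcl := closure_eq_of_subset_line hL (hsub.trans Finset.inter_subset_left) hr
  have hPflat := (mem_planes.1 hP).2.1
  have hsubP : (({a, b} : Finset α) : Set α) ⊆ (P : Set α) := Finset.coe_subset.2 (hsub.trans Finset.inter_subset_right)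
  have := M.closure_subset_closure hsubP
  rw [hPflat.closure, hcl] at this
  exact Finset.coe_subset.1 this

/-- §22.3 (first identity), as the double count of the pairs `(ℓ, x)` with `|ℓ ∩ G| = m` and `x ∈ G ∖ ℓ`:
`Σ_{P ∈ planes M} inc(P ∩ G, m)·(|P ∩ G| − m) = (g − m)·b_m` for `m ≥ 2`. -/
theorem sum_inc_mul_eq (hs : Simple M) (hG : G ⊆ gr M) {m : ℕ} (hm : 2 ≤ m) :
    ∑ P ∈ planes M, inc M (P ∩ G) m * ((P ∩ G).card - m) = (G.card - m) * bLines M G m := by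
  -- both sides count `#((lines with |ℓ ∩ G| = m) × (points of G off ℓ))`
  unfold bLines inc
  -- right side: `Σ_{ℓ : |ℓ ∩ G| = m} |G ∖ ℓ|`
  have hR : (G.card - m) * ((lines M).filter (fun L : Finset α => (L ∩ G).card = m)).card =
      ∑ L ∈ (lines M).filter (fun L : Finset α => (L ∩ G).card = m), (G \ L).card := by
    rw [mul_comm, ← smul_eq_mul, ← Finset.sum_const]
    refine Finset.sum_congr rfl (fun L hL => ?_)
    have hLm := (Finset.mem_filter.1 hL).2
    rw [Finset.card_sdiff, hLm]
  rw [hR]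
  -- left side: for each plane, the pairs `(ℓ, x)` with `|ℓ ∩ (P ∩ G)| = m`, `x ∈ (P ∩ G) ∖ ℓ`
  have hL : ∀ P ∈ planes M, ((lines M).filter (fun L : Finset α => (L ∩ (P ∩ G)).card = m)).card * ((P ∩ G).card - m) =
      ∑ L ∈ (lines M).filter (fun L : Finset α => (L ∩ (P ∩ G)).card = m), ((P ∩ G) \ L).card := by
    intro P _
    rw [← smul_eq_mul, ← Finset.sum_const]
    refine Finset.sum_congr rfl (fun L hL => ?_)
    have hLm := (Finset.mem_filter.1 hL).2
    rw [Finset.card_sdiff, hLm]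
  rw [Finset.sum_congr rfl hL]
  -- both are the cardinality of a sigma finset; swap the summation order via `sum_comm'`
  rw [Finset.sum_congr rfl (fun P _ => Finset.sum_congr rfl (fun L _ => Finset.card_eq_sum_ones _)),
    Finset.sum_congr rfl (fun L _ => Finset.card_eq_sum_ones _)]
  -- `Σ_P Σ_{L : |L ∩ P ∩ G| = m} Σ_{x ∈ (P ∩ G) ∖ L} 1 = Σ_{L : |L ∩ G| = m} Σ_{x ∈ G ∖ L} 1`
  have key : ∀ P L, (P ∈ planes M ∧ L ∈ (lines M).filter (fun L : Finset α => (L ∩ (P ∩ G)).card = m)) ↔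
      (P ∈ (planes M).filter (fun P : Finset α => L ⊆ P) ∧ L ∈ (lines M).filter (fun L : Finset α => (L ∩ G).card = m)) := by
    intro P L
    simp only [Finset.mem_filter]
    constructor
    · rintro ⟨hP, hL, hLm⟩
      have hLP : L ⊆ P := line_subset_plane_of_two_le hs hL hP (by
        calc 2 ≤ m := hm
          _ = (L ∩ (P ∩ G)).card := hLm.symm
          _ ≤ (L ∩ P).card := Finset.card_le_card (by
              intro x hx
              simp only [Finset.mem_inter] at hx ⊢
              exact ⟨hx.1, hx.2.1⟩))
      refine ⟨⟨hP, hLP⟩, hL, ?_⟩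
      rw [← hLm]
      congr 1
      ext x
      simp only [Finset.mem_inter]
      exact ⟨fun h => ⟨h.1, hLP h.1, h.2⟩, fun h => ⟨h.1, h.2.2⟩⟩
    · rintro ⟨⟨hP, hLP⟩, hL, hLm⟩
      refine ⟨hP, hL, ?_⟩
      rw [← hLm]
      congr 1
      ext x
      simp only [Finset.mem_inter]
      exact ⟨fun h => ⟨h.1, h.2.2⟩, fun h => ⟨h.1, hLP h.1, h.2⟩⟩
  rw [Finset.sum_comm' key]
  refine Finset.sum_congr rfl (fun L hL => ?_)
  obtain ⟨hLl, hLm⟩ := Finset.mem_filter.1 hL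
  -- for a fixed line `ℓ`: the planes through `ℓ` partition `G ∖ ℓ` via `x ↦ cl(ℓ ∪ x)`
  rw [← Finset.sum_fiberwise_of_maps_to (s := G \ L) (t := (planes M).filter (fun P : Finset α => L ⊆ P))
    (g := fun x => clF M (insert x L)) (fun x hx => ?_)]
  · refine Finset.sum_congr rfl (fun P hP => ?_)
    obtain ⟨hP, hLP⟩ := Finset.mem_filter.1 hP
    -- the fibre of `P` is `(P ∩ G) ∖ ℓ`
    have hfib : (G \ L).filter (fun x => clF M (insert x L) = P) = (P ∩ G) \ L := by
      ext x
      simp only [Finset.mem_filter, Finset.mem_sdiff, Finset.mem_inter]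
      constructor
      · rintro ⟨⟨hxG, hxL⟩, hcl⟩
        refine ⟨⟨?_, hxG⟩, hxL⟩
        rw [← hcl, ← Finset.mem_coe, coe_clF]
        exact M.mem_closure_of_mem' (Finset.mem_coe.2 (Finset.mem_insert_self x L))
          (by rw [← coe_gr M]; exact Finset.mem_coe.2 (hG hxG))
      · rintro ⟨⟨hxP, hxG⟩, hxL⟩
        refine ⟨⟨hxG, hxL⟩, ?_⟩
        apply Finset.coe_injective
        rw [coe_clF]
        have hLL : L ⊆ L := Finset.Subset.refl L
        have h2 : 2 ≤ L.card := by
          have := (mem_lines.1 hLl).2.2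
          have hle := M.eRk_le_encard (L : Set α)
          rw [this, Set.encard_coe_eq_coe_finsetCard] at hle
          exact_mod_cast hle
        have hr3 := eRk_insert_eq_three hs hLl hLL h2 (hG hxG) hxL
        exact closure_eq_of_subset_plane hP (Finset.insert_subset hxP hLP) hr3
    rw [hfib]
  · rw [Finset.mem_sdiff] at hx
    rw [Finset.mem_filter]
    have h2 : 2 ≤ L.card := by
      have := (mem_lines.1 hLl).2.2
      have hle := M.eRk_le_encard (L : Set α)
      rw [this, Set.encard_coe_eq_coe_finsetCard] at hle
      exact_mod_cast hle
    have hr3 := eRk_insert_eq_three hs hLl (Finset.Subset.refl L) h2 (hG hx.1) hx.2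
    have hLE : L ⊆ gr M := (mem_lines.1 hLl).1
    obtain ⟨hP, hsub⟩ := clF_mem_planes (Finset.insert_subset (hG hx.1) hLE) hr3
    exact ⟨hP, (Finset.subset_insert x L).trans hsub⟩

end PercRepro.SixFour
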